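import Mathlib
import Literature.Barriers.ValiantsHypothesis.AlgebraicNaturalProofs
import Summits.ValiantsHypothesis.ValiantsHypothesis.Theorems.BarrierLeverSuccinctHittingSetsForVPStubPartitionRankMaximal
import HarnessLib

/-!
# Crux `BarrierLever.SuccinctHittingSetsForVP` (stmt-ValiantsHypothesis-14610), line `registered` —
stub `stub_partitionDeterminantHit`: NISAN'S BALANCED PARTITION DETERMINANTS ARE HIT BY SMALL CIRCUITS

**What is proved (unconditional; a worker-sized stub carved from the open heart, it does NOT close
the item).** In FSV's framework over `ℂ` (tree regime `d = n`, simple class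
`SmallCircuits ℂ n b = {f : deg f ≤ n, L(f) ≤ n^b}`):

* `stub_partitionDeterminantHit` : for `n ≥ 2`, `2h ≤ n` and ANY bijection `e` between the rows
  (monomials `p` in `x_0, …, x_{h-1}` with `2|p| ≤ n`) and the columns (monomials `q` in
  `x_h, …, x_{2h-1}` with `2|q| ≤ n`) of the square BALANCED partition coefficient matrix
  `M_f[p, p'] = coeff_{p + e p'} f` (Nisan 1991 / Raz 2009), the class `SmallCircuits ℂ n 2` hits
  every polynomial `D` in the coefficient variables whose value at every coefficient vector is
  `det M_f`: some `f ∈ SmallCircuits ℂ n 2` has `det M_f ≠ 0`. So the vanishing of this partition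
  determinant is never an equation for the simple class: it is not an algebraically natural proof.

**Witness and proof.** The witness of `stub_partitionRankMaximal` (p161911) with `k = ⌊n/2⌋`:
`f = Σ_{j ≤ k} S^j`, `S = Σ_{i < h} x_i x_{i+h}`; `deg f ≤ 2k ≤ n`, `L(f) ≤ k (2h + 2) ≤ n²`
(`PartitionRankMaximal.totalDegree_witness_le`, `complexity_witness_le`). Every row `p` has
`|p| ≤ k`, and `shift p` (exponents moved from `x_i` to `x_{i+h}`) is a column. If `det M_f = 0`, a
nonzero `v` has `v ᵥ* M_f = 0` (`Matrix.exists_vecMul_eq_zero_iff`); at the column `p' = e⁻¹(shift p₀)`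
the entries `coeff_{p + shift p₀} f` vanish for `p ≠ p₀` (`coeff_witness_eq_zero`: monomials of `f`
are balanced) and the diagonal one is `≠ 0` (`coeff_witness_ne_zero`), so `v p₀ = 0` for every `p₀`,
a contradiction. No new definitions. Axioms: `propext`, `Classical.choice`, `Quot.sound`.

References: [Nisan1991Noncommutative] (rank of the partition matrix); [Raz2009] §1 (coefficient
matrix of a variable partition, full rank); [ForbesShpilkaVolk2018] Question 6, Cor. 5 (framework).
-/

-- layout Summits/ValiantsHypothesis/ValiantsHypothesis forces the duplicated namespace component
set_option linter.dupNamespace false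

namespace Summit.ValiantsHypothesis.ValiantsHypothesis.Theorems.BarrierLever.SuccinctHittingSetsForVP

open Literature.Barriers.ValiantsHypothesis Literature.Computability.AlgebraicComplexity MvPolynomial

namespace PartitionDeterminantHit

open PartitionRankMaximal

variable {n : ℕ} {c : Fin n}

/-- If `supp x ⊆ [0, c)` and `2c ≤ n`, the shifted exponent `shift x = x.mapDomain (· + c)` is
supported below `2c`. [folklore] -/
theorem lt_of_mem_support_mapDomain (hc : 2 * (c : ℕ) ≤ n) {x : Fin n →₀ ℕ}
    (hx : ∀ i ∈ x.support, (i : ℕ) < c) {j : Fin n}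
    (hj : j ∈ (x.mapDomain (· + c)).support) : (j : ℕ) < 2 * (c : ℕ) := by
  classical
  obtain ⟨i, hi, rfl⟩ := Finset.mem_image.mp (Finsupp.mapDomain_support hj)
  have hic : (i : ℕ) < c := hx i hi
  have hi' : (i : ℕ) + (c : ℕ) < n := by omega
  show (((i + c : Fin n)) : ℕ) < 2 * (c : ℕ)
  rw [Fin.val_add_eq_of_add_lt hi']
  omega

/-- The shift `p ↦ shift p` sends a row index (a monomial in `x_0, …, x_{c-1}` with `2|p| ≤ n`) to
a column index (a monomial in `x_c, …, x_{2c-1}` with `2|shift p| ≤ n`; `2c ≤ n`). [folklore] -/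
theorem shift_mem_cols (hc : 2 * (c : ℕ) ≤ n) {p : Fin n →₀ ℕ}
    (hp : (∀ i ∈ p.support, (i : ℕ) < c) ∧ 2 * p.degree ≤ n) :
    (∀ i ∈ (p.mapDomain (· + c)).support, (c : ℕ) ≤ (i : ℕ) ∧ (i : ℕ) < 2 * (c : ℕ)) ∧
      2 * (p.mapDomain (· + c)).degree ≤ n :=
  ⟨fun _ hi => ⟨le_of_mem_support_mapDomain hc hp.1 hi, lt_of_mem_support_mapDomain hc hp.1 hi⟩,
    by rw [Finsupp.degree_mapDomain]; exact hp.2⟩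

/-- **The balanced partition coefficient matrix of the witness is nonsingular.** For
`f = Σ_{j ≤ k} S^j`, `S = Σ_{i < c} x_i x_{i+c}` (`2c ≤ n ≤ 2k + 1`), and any bijection `e` from
the rows (monomials `p` in `x_0, …, x_{c-1}`, `2|p| ≤ n`) to the columns (monomials in
`x_c, …, x_{2c-1}`, `2|q| ≤ n`), `det [coeff_{p + e p'} f]_{p, p'} ≠ 0`: a vector `v` with
`v ᵥ* M = 0` (`Matrix.exists_vecMul_eq_zero_iff`) vanishes, since at the column
`p' = e⁻¹ (shift p₀)` only the row `p₀` carries a nonzero entry (`coeff_witness_eq_zero`,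
`coeff_witness_ne_zero`, `|p₀| ≤ k`). [folklore] -/
theorem det_witness_ne_zero {S : MvPolynomial (Fin n) ℂ}
    (hS : S = ∑ i ∈ Finset.univ.filter (fun i : Fin n => (i : ℕ) < c), X i * X (i + c))
    (hc : 2 * (c : ℕ) ≤ n) {k : ℕ} (hk : n ≤ 2 * k + 1)
    [Fintype {p : Fin n →₀ ℕ // (∀ i ∈ p.support, (i : ℕ) < c) ∧ 2 * p.degree ≤ n}]
    (e : {p : Fin n →₀ ℕ // (∀ i ∈ p.support, (i : ℕ) < c) ∧ 2 * p.degree ≤ n} ≃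
      {q : Fin n →₀ ℕ // (∀ i ∈ q.support, (c : ℕ) ≤ (i : ℕ) ∧ (i : ℕ) < 2 * (c : ℕ)) ∧
        2 * q.degree ≤ n}) :
    (Matrix.of fun p p' : {p : Fin n →₀ ℕ // (∀ i ∈ p.support, (i : ℕ) < c) ∧ 2 * p.degree ≤ n} =>
        coeff (p.1 + (e p').1) (∑ j ∈ Finset.range (k + 1), S ^ j)).det ≠ 0 := by
  intro hdet
  obtain ⟨v, hv0, hv⟩ := Matrix.exists_vecMul_eq_zero_iff.mpr hdet
  refine hv0 (funext fun p₀ => ?_)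
  have key := congrFun hv (e.symm ⟨p₀.1.mapDomain (· + c), shift_mem_cols hc p₀.2⟩)
  simp only [Matrix.vecMul, dotProduct, Matrix.of_apply, Pi.zero_apply,
    Equiv.apply_symm_apply] at key
  rw [Finset.sum_eq_single p₀] at key
  · exact (mul_eq_zero.mp key).resolve_right
      (coeff_witness_ne_zero hS hc p₀.2.1 (by have := p₀.2.2; omega))
  · intro p _ hne
    rw [coeff_witness_eq_zero hS hc k p.2.1 p₀.2.1 (fun h => hne (Subtype.ext h)), mul_zero]
  · intro h
    exact absurd (Finset.mem_univ p₀) h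

end PartitionDeterminantHit

open PartitionRankMaximal PartitionDeterminantHit in
/-- **Registered stub `stub_partitionDeterminantHit`** (crux stmt-ValiantsHypothesis-14610, line
`registered`; Nisan's balanced partition determinants are hit): for `n ≥ 2`, `2h ≤ n` and any
bijection `e` between the monomials `p` in `x_0, …, x_{h-1}` with `2|p| ≤ n` (rows) and the
monomials `q` in `x_h, …, x_{2h-1}` with `2|q| ≤ n` (columns), `SmallCircuits ℂ n 2` hits every
polynomial in the coefficient variables whose value at every coefficient vector is the determinant
of the square partition coefficient matrix `[coeff_{p + e p'} f]_{p, p'}` (Nisan 1991 / Raz 2009).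
Witness `f = Σ_{d ≤ n/2} (Σ_{i < h} x_i x_{h+i})^d` of `stub_partitionRankMaximal` (size
`≤ (n/2) (2h + 2) ≤ n²`, degree `≤ n`): its matrix is a nonzero diagonal times the permutation
`e⁻¹ ∘ shift`, so its determinant is nonzero (`PartitionDeterminantHit.det_witness_ne_zero`).
(Framework: Forbes–Shpilka–Volk 2018, Question 6 / Cor. 5.) [cite: Raz2009, §1] -/
theorem stub_partitionDeterminantHit :
    ∀ n h : ℕ, 2 ≤ n → 2 * h ≤ n →
      ∀ [Fintype {p : Fin n →₀ ℕ // (∀ i ∈ p.support, (i : ℕ) < h) ∧ 2 * p.degree ≤ n}]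
        (e : {p : Fin n →₀ ℕ // (∀ i ∈ p.support, (i : ℕ) < h) ∧ 2 * p.degree ≤ n} ≃
          {q : Fin n →₀ ℕ // (∀ i ∈ q.support, h ≤ (i : ℕ) ∧ (i : ℕ) < 2 * h) ∧ 2 * q.degree ≤ n}),
      IsSuccinctHittingSet (degLEMonomials n) (SmallCircuits ℂ n 2)
        {D | ∀ f : MvPolynomial (Fin n) ℂ, MvPolynomial.eval (coeffVector (degLEMonomials n) f) D =
          (Matrix.of fun p p' : {p : Fin n →₀ ℕ // (∀ i ∈ p.support, (i : ℕ) < h) ∧ 2 * p.degree ≤ n} =>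
            MvPolynomial.coeff (p.1 + (e p').1) f).det} := by
  intro n h hn hh
  obtain ⟨c, rfl⟩ : ∃ c : Fin n, (c : ℕ) = h := ⟨⟨h, by omega⟩, rfl⟩
  intro _ e D hD hD0
  simp only [Set.mem_setOf_eq] at hD
  set S : MvPolynomial (Fin n) ℂ :=
    ∑ i ∈ Finset.univ.filter (fun i : Fin n => (i : ℕ) < c), X i * X (i + c) with hS
  have hk : 2 * (n / 2) ≤ n := Nat.mul_div_le n 2
  refine ⟨∑ j ∈ Finset.range (n / 2 + 1), S ^ j,
    ⟨(totalDegree_witness_le hS (n / 2)).trans hk, (complexity_witness_le hS (n / 2)).trans ?_⟩, ?_⟩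
  · -- `(n/2) (2c + 2) ≤ n²` from `2 (n/2) ≤ n`, `2c ≤ n`, `2 ≤ n`
    have key : 2 * ((n / 2) * (2 * (c : ℕ) + 2)) ≤ 2 * n ^ 2 :=
      calc 2 * ((n / 2) * (2 * (c : ℕ) + 2)) = (2 * (n / 2)) * (2 * (c : ℕ) + 2) := by ring
        _ ≤ n * (2 * (c : ℕ) + 2) := Nat.mul_le_mul_right _ hk
        _ ≤ n * (n + n) := Nat.mul_le_mul_left _ (by omega)
        _ = 2 * n ^ 2 := by ring
    omega
  · rw [hD]
    exact det_witness_ne_zero hS hh (by omega) e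

end Summit.ValiantsHypothesis.ValiantsHypothesis.Theorems.BarrierLever.SuccinctHittingSetsForVP
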